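import Literature.Computability.Cryptography.ChenQuantumLWEClassTwirl

/-!
# The class twirl is sharp: outside the annihilator the Gram entries separate the secrets (T4, sharpness)

REPRODUCTION / ANALYSIS OF A CLAIMED RESULT UNDER ADJUDICATION (withdrawn): Yilei Chen, *Quantum
Algorithms for Lattice Problems*, IACR ePrint 2024/555, version of 2024-04-18 [ChenQuantumLattice2024]
(the version carrying the author's note that Step 9 contains a bug), Step 9 (§3.5.9, pp. 34–38) acting
on `|φ8.b⟩ = Σ_{j ∈ ℤ_P} e(-j²/P) |2D²j·b + v′ mod N⟩` (p. 35), `P = p₁Q`, `N = D²P`.  Bundle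
`papers/QuantumAdvantage/lwe-quantum-autopsy/`, Part 2 (`REPAIR-CENSUS.md` §1 theorem **T4**, clause
"sharp", and §9), companion of `ChenQuantumLWEClassTwirl.lean`.
HONEST FRAMING: kernel-checked THEOREMS about a state occurring in a WITHDRAWN algorithm — the exact
converse of a no-go (which offset knowledge WOULD separate secrets), NOT summit progress, no cryptanalytic
claim in either direction, no new algorithm; quantum lower bounds are out of scope.

## What is proved

`ChenQuantumLWEClassTwirl` shows: the Fourier-side Gram entry `ρ̂_{b,v′}(u,u′)` of `|φ8.b⟩` does not
depend on the unknown coordinates (`U`) of `b` whenever the difference `η = u′ − u` lies in the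
annihilator `K^⊥ = {η : η_i ≡ 0 (mod Q) for i ∈ U, ⟨bk, η mod P⟩ ≡ 0 (mod Q)}` of the class `K`, and the
class twirl kills all other entries.  Here we prove that `K^⊥` is EXACTLY the secret-blind set
(odd `P = p₁Q`, `gcd(p₁,Q) = 1` — Chen's C.3; `U ≠ ∅`, else there is nothing to hide):

* `expDiff_add_single`: the chirp exponents of `b` and of `b + k·e_i` differ, at `(u, u+η)`, by
  `k·(2(t(u)η̃_i + ũ_i σ + σ η̃_i) + k(2ũ_i η̃_i + η̃_i²))` in `ℤ_P` (`t = lineFun b`, `σ = t(η)`,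
  tildes = reduction mod `P`).
* `exp_eq_of_fourierGram_eq`: equal Gram entries force equal chirp exponents (`|G|² = P ≠ 0`,
  `ψ_N ≠ 0`, injectivity of `ψ_P`).
* **`fourierGram_separates`** (T4 is sharp): for every `η ∉ K^⊥` there are an unknown coordinate
  `i ∈ U`, an integer `m` and an outcome `u` with
  `ρ̂_{b,v′}(u,u+η) ≠ ρ̂_{b + 2p₁m·e_i, v′}(u,u+η)` — and `b + 2p₁m·e_i` is again a secret of the SAME
  instance class (same planted part, still `≡ 0 (mod 2p₁)` on `U`).  Proof: if the coordinate condition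
  fails at `i` (`η_i ≢ 0 mod Q`), the four candidates `m ∈ {1,2}`, `u ∈ {0, e_i}` cannot all agree, since
  agreement forces `2p₁·η̃_i ≡ 0`, i.e. `η_i ≡ 0 (mod Q)` (units `2`, `p₁` mod `Q`); if all coordinate
  conditions hold but `⟨bk,η⟩ ≢ 0 (mod Q)`, then `m = 1`, `u = e_i` gives exponent difference `4p₁σ ≠ 0`.
* `sum_fourierGram_shift`: averaging the offset over ANY finite family `F` of shifts annihilated by `η`
  (`ψ_N(⟨d,η⟩) = 1` for `d ∈ F`) multiplies the entry `(u,u+η)` by `|F|`; hence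
  **`finerTwirl_separates`**: the `F`-averaged Gram entries of `b` and `b + 2p₁m·e_i` still differ — no
  twirl over a class finer than `K` at `η` (in particular over any subgroup `K′ ⊊ K` with `η ∈ K′^⊥`) is
  secret-blind.  `Shape.fourierGram_separates` is the admissible-shape form.

Reading (census §1 T4 "sharp", §5 O1/O2): side information about the offset strictly beyond the class
`K` is not only sufficient (AC4, `ChenQuantumLWEChirpFourier.Shape.weight_qft_kick_phi8b_of_correct`)
but the ONLY kind of input that can make a processing of `|φ8.b⟩` secret-sensitive on average: every
frequency difference outside `K^⊥` already distinguishes two secrets of the same class.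

## What is NOT here

Which differences `η` a concrete post-processing can exploit is not modelled (that is the census's §0
inventory); even `P` (where `|φ8.b⟩` may vanish) is excluded by hypothesis; nothing about Steps 1–8.

References: [ChenQuantumLattice2024] as above (eq. (12) p. 17: `b_i ∈ 2p₁ℤ` on the unknown coordinates;
C.3 p. 18: `p₁, …, p_κ` distinct odd primes); [ZhangExactCoset2025] Y. Zhang, arXiv:2509.12341, p. 22
(AC4 — the known-sufficient side information); [Korobov1992] Ch. I §3 (`|G|² = P`).
-/

namespace Literature.Computability.Cryptography.Chen2024

open scoped BigOperators

section Sharp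

variable (n : ℕ) (D p₁ Q : ℕ+)

/-! ### Perturbing one unknown coordinate of the secret -/

/-- `lineFun` is additive in the outcome. [folklore] -/
theorem lineFun_add (b : Fin (n + 1) → ℤ) (u η : Fin (n + 1) → ZN D p₁ Q) :
    lineFun n D p₁ Q b (u + η) = lineFun n D p₁ Q b u + lineFun n D p₁ Q b η := by
  unfold lineFun
  rw [← Finset.sum_add_distrib]
  refine Finset.sum_congr rfl fun i _ => ?_
  rw [Pi.add_apply, map_add, mul_add]

/-- Changing the coordinate `i` of `b` by `k` changes `lineFun b u = ⟨b, u mod P⟩` by `k·ũ_i`.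
[folklore] -/
theorem lineFun_add_single (b : Fin (n + 1) → ℤ) (i : Fin (n + 1)) (k : ℤ)
    (u : Fin (n + 1) → ZN D p₁ Q) :
    lineFun n D p₁ Q (b + Pi.single i k) u
      = lineFun n D p₁ Q b u + (k : ZP p₁ Q) * toP D (p₁ * Q) (u i) := by
  unfold lineFun
  have hsplit : ∀ j,
      (((b + Pi.single i k : Fin (n + 1) → ℤ) j : ℤ) : ZP p₁ Q) * toP D (p₁ * Q) (u j)
      = ((b j : ℤ) : ZP p₁ Q) * toP D (p₁ * Q) (u j)
        + (((Pi.single i k : Fin (n + 1) → ℤ) j : ℤ) : ZP p₁ Q) * toP D (p₁ * Q) (u j) := by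
    intro j
    rw [Pi.add_apply, Int.cast_add, add_mul]
  have hsingle :
      ∑ j, (((Pi.single i k : Fin (n + 1) → ℤ) j : ℤ) : ZP p₁ Q) * toP D (p₁ * Q) (u j)
        = (k : ZP p₁ Q) * toP D (p₁ * Q) (u i) := by
    rw [Finset.sum_eq_single i (fun j _ hj => by rw [Pi.single_eq_of_ne hj, Int.cast_zero, zero_mul])
      (fun h => absurd (Finset.mem_univ i) h), Pi.single_eq_same]
  rw [Finset.sum_congr rfl fun j _ => hsplit j, Finset.sum_add_distrib, hsingle]

/-- `lineFun b` at the basis outcome `w·e_i` is `b_i·w̃`. [folklore] -/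
theorem lineFun_single (b : Fin (n + 1) → ℤ) (i : Fin (n + 1)) (w : ZN D p₁ Q) :
    lineFun n D p₁ Q b (Pi.single i w) = ((b i : ℤ) : ZP p₁ Q) * toP D (p₁ * Q) w := by
  unfold lineFun
  rw [Finset.sum_eq_single i (fun j _ hj => by rw [Pi.single_eq_of_ne hj, map_zero, mul_zero])
      (fun h => absurd (Finset.mem_univ i) h), Pi.single_eq_same]

/-- The difference of the chirp exponents `t(u)² − t(u+η)²` for the secrets `b` and `b + k·e_i`
(`t = lineFun`, `σ = t(η)`):  `k·(2(t(u)η̃_i + ũ_iσ + ση̃_i) + k(2ũ_iη̃_i + η̃_i²))`.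
[cite: ChenQuantumLattice2024, §3.5.9 p. 35 (the phase `e(-j²/P)` of `|φ8.b⟩`)] -/
theorem expDiff_add_single (b : Fin (n + 1) → ℤ) (i : Fin (n + 1)) (k : ℤ)
    (u η : Fin (n + 1) → ZN D p₁ Q) :
    (lineFun n D p₁ Q b u ^ 2 - lineFun n D p₁ Q b (u + η) ^ 2)
      - (lineFun n D p₁ Q (b + Pi.single i k) u ^ 2
          - lineFun n D p₁ Q (b + Pi.single i k) (u + η) ^ 2)
      = (k : ZP p₁ Q) *
          (2 * (lineFun n D p₁ Q b u * toP D (p₁ * Q) (η i)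
                + toP D (p₁ * Q) (u i) * lineFun n D p₁ Q b η
                + lineFun n D p₁ Q b η * toP D (p₁ * Q) (η i))
            + (k : ZP p₁ Q) * (2 * toP D (p₁ * Q) (u i) * toP D (p₁ * Q) (η i)
                + toP D (p₁ * Q) (η i) ^ 2)) := by
  rw [lineFun_add_single, lineFun_add_single, lineFun_add, Pi.add_apply, map_add]
  ring

/-! ### Equal Gram entries force equal chirp exponents -/

/-- For odd `P` the common factor `|G|²·ψ_N(⟨v′,u′−u⟩)` of the Gram entries is non-zero, so equal
entries for `b` and `b′` force `t_b(u)² − t_b(u′)² = t_{b′}(u)² − t_{b′}(u′)²` in `ℤ_P`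
(`ψ_P` is injective). [cite: Korobov1992, Ch. I §3 (|G|² = P)] -/
theorem exp_eq_of_fourierGram_eq (hP : Odd ((p₁ * Q : ℕ+) : ℕ)) (b b' v' : Fin (n + 1) → ℤ)
    (u u' : Fin (n + 1) → ZN D p₁ Q)
    (h : fourierGram n D p₁ Q b v' u u' = fourierGram n D p₁ Q b' v' u u') :
    lineFun n D p₁ Q b u ^ 2 - lineFun n D p₁ Q b u' ^ 2
      = lineFun n D p₁ Q b' u ^ 2 - lineFun n D p₁ Q b' u' ^ 2 := by
  rw [fourierGram_eq, fourierGram_eq] at h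
  have hGG : lineGauss p₁ Q 0 * (starRingEnd ℂ) (lineGauss p₁ Q 0) ≠ 0 := by
    rw [Complex.mul_conj, Complex.normSq_eq_norm_sq, norm_sq_lineGauss_zero p₁ Q hP]
    exact_mod_cast PNat.ne_zero (p₁ * Q)
  have hψ := stdAddChar_ne_zero (offsetFun n D p₁ Q v' (u' - u))
  exact ZMod.injective_stdAddChar (mul_left_cancel₀ hψ (mul_right_cancel₀ hGG h))

/-- Converse of the T4 mechanism: `p₁·z = 0` in `ℤ_P` forces `z ≡ 0 (mod Q)`. [folklore] -/
theorem toQ_eq_zero_of_p₁_mul_eq_zero {z : ZP p₁ Q} (h : ((p₁ : ℕ) : ZP p₁ Q) * z = 0) :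
    toQ p₁ Q z = 0 := by
  have hz : (((p₁ : ℕ) * z.val : ℕ) : ZP p₁ Q) = 0 := by
    rw [Nat.cast_mul, ZMod.natCast_zmod_val]
    exact h
  obtain ⟨k, hk⟩ := (ZMod.natCast_eq_zero_iff _ _).1 hz
  have hQ : ((Q : ℕ+) : ℕ) ∣ z.val := by
    refine ⟨k, Nat.eq_of_mul_eq_mul_left (PNat.pos p₁) ?_⟩
    rw [hk, PNat.mul_coe, mul_assoc]
  rw [← ZMod.natCast_zmod_val z, map_natCast, (ZMod.natCast_eq_zero_iff _ _).2 hQ]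

/-! ### T4 is sharp -/

/-- **T4 is sharp** (`REPAIR-CENSUS.md` §1 T4, clause "sharp").  Let `P = p₁Q` be odd with
`gcd(p₁, Q) = 1` (C.3), `U ≠ ∅` the unknown coordinates, `bk = b` off `U`.  If the frequency
difference `η` is NOT in the annihilator `K^⊥` (some `η_i ≢ 0 (mod Q)` with `i ∈ U`, or
`⟨bk, η mod P⟩ ≢ 0 (mod Q)`), then the Gram entry at `(u, u+η)` separates `b` from the secret
`b + 2p₁m·e_i` of the same instance class, for some `i ∈ U`, `m ∈ ℤ`, `u`.  So `K^⊥` is exactly the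
secret-blind set of `fourierGram_indep_of_ann`.
[cite: ChenQuantumLattice2024, eq. (12) p. 17 (b_i ∈ 2p₁ℤ), C.3 p. 18, §3.5.9 p. 35] -/
theorem fourierGram_separates (hP : Odd ((p₁ * Q : ℕ+) : ℕ))
    (hcop : Nat.Coprime (p₁ : ℕ) (Q : ℕ)) (U : Finset (Fin (n + 1)))
    (bk b v' : Fin (n + 1) → ℤ) (hbk : ∀ j, j ∉ U → bk j = b j)
    (η : Fin (n + 1) → ZN D p₁ Q) (hU : U.Nonempty)
    (hη : ¬ ((∀ j ∈ U, toQ p₁ Q (toP D (p₁ * Q) (η j)) = 0)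
              ∧ toQ p₁ Q (lineFun n D p₁ Q bk η) = 0)) :
    ∃ i ∈ U, ∃ m : ℤ, ∃ u : Fin (n + 1) → ZN D p₁ Q,
      fourierGram n D p₁ Q b v' u (u + η)
        ≠ fourierGram n D p₁ Q (b + Pi.single i (2 * ((p₁ : ℕ) : ℤ) * m)) v' u (u + η) := by
  have hQodd : Odd ((Q : ℕ+) : ℕ) := by
    have h := hP
    rw [PNat.mul_coe] at h
    exact (Nat.odd_mul.mp h).2
  have h2 : IsUnit (2 : ZQ Q) := Literature.NumberTheory.GaussSums.isUnit_two_zmod_of_odd _ hQodd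
  have hp₁ : IsUnit ((p₁ : ℕ) : ZQ Q) := (ZMod.isUnit_iff_coprime _ _).2 hcop
  by_cases hcoord : ∀ j ∈ U, toQ p₁ Q (toP D (p₁ * Q) (η j)) = 0
  · -- every coordinate condition holds, so the line condition fails: perturb any unknown
    -- coordinate by `2p₁` and read the entry at `u = e_i`
    have hline : toQ p₁ Q (lineFun n D p₁ Q bk η) ≠ 0 := fun h => hη ⟨hcoord, h⟩
    obtain ⟨i, hi⟩ := hU
    refine ⟨i, hi, 1, Pi.single i 1, fun h => hline ?_⟩
    have E :=
      (expDiff_add_single n D p₁ Q b i (2 * ((p₁ : ℕ) : ℤ) * 1) (Pi.single i 1) η).symm.trans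
        (sub_eq_zero.2 (exp_eq_of_fourierGram_eq n D p₁ Q hP _ _ v' _ _ h))
    rw [Pi.single_eq_same, map_one] at E
    simp only [Int.cast_mul, Int.cast_ofNat, Int.cast_natCast, Int.cast_one] at E
    obtain ⟨y₀, hy₀⟩ := exists_eq_Q_mul_of_toQ_eq_zero p₁ Q (hcoord i hi)
    have hPy : ((p₁ : ℕ) : ZP p₁ Q) * toP D (p₁ * Q) (η i) = 0 := by
      rw [hy₀, ← mul_assoc, p₁_mul_Q_eq_zero, zero_mul]
    have key : ((p₁ : ℕ) : ZP p₁ Q) * (2 * 2 * lineFun n D p₁ Q b η) = 0 := by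
      linear_combination E
        - (4 * lineFun n D p₁ Q b (Pi.single i 1) + 4 * lineFun n D p₁ Q b η
            + 8 * ((p₁ : ℕ) : ZP p₁ Q) + 4 * ((p₁ : ℕ) : ZP p₁ Q) * toP D (p₁ * Q) (η i)) * hPy
    have hq := toQ_eq_zero_of_p₁_mul_eq_zero p₁ Q key
    rw [map_mul, map_mul, map_ofNat, toQ_lineFun_eq n D p₁ Q U b bk hbk η hcoord] at hq
    exact ((h2.mul h2).mul_right_eq_zero).1 hq
  · -- a coordinate condition fails at some `i ∈ U`: the four candidates `m ∈ {1,2}`,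
    -- `u ∈ {0, e_i}` cannot all agree
    push Not at hcoord
    obtain ⟨i, hi, hy⟩ := hcoord
    refine ⟨i, hi, ?_⟩
    by_contra hall
    push Not at hall
    have E : ∀ (m : ℤ) (u : Fin (n + 1) → ZN D p₁ Q),
        ((2 * ((p₁ : ℕ) : ℤ) * m : ℤ) : ZP p₁ Q) *
          (2 * (lineFun n D p₁ Q b u * toP D (p₁ * Q) (η i)
                + toP D (p₁ * Q) (u i) * lineFun n D p₁ Q b η
                + lineFun n D p₁ Q b η * toP D (p₁ * Q) (η i))
            + ((2 * ((p₁ : ℕ) : ℤ) * m : ℤ) : ZP p₁ Q)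
              * (2 * toP D (p₁ * Q) (u i) * toP D (p₁ * Q) (η i) + toP D (p₁ * Q) (η i) ^ 2)) = 0 :=
      fun m u => (expDiff_add_single n D p₁ Q b i (2 * ((p₁ : ℕ) : ℤ) * m) u η).symm.trans
        (sub_eq_zero.2 (exp_eq_of_fourierGram_eq n D p₁ Q hP _ _ v' _ _ (hall m u)))
    have E10 := E 1 0
    have E11 := E 1 (Pi.single i 1)
    have E20 := E 2 0
    have E21 := E 2 (Pi.single i 1)
    rw [lineFun_zero, Pi.zero_apply, map_zero] at E10 E20
    rw [lineFun_single, Pi.single_eq_same, map_one, mul_one] at E11 E21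
    simp only [Int.cast_mul, Int.cast_ofNat, Int.cast_natCast, Int.cast_one] at E10 E11 E20 E21
    have k1 : ((p₁ : ℕ) : ZP p₁ Q) *
        (4 * (((b i : ℤ) : ZP p₁ Q) * toP D (p₁ * Q) (η i) + lineFun n D p₁ Q b η
              + 2 * ((p₁ : ℕ) : ZP p₁ Q) * toP D (p₁ * Q) (η i))) = 0 := by
      linear_combination E11 - E10
    have k2 : ((p₁ : ℕ) : ZP p₁ Q) *
        (8 * (((b i : ℤ) : ZP p₁ Q) * toP D (p₁ * Q) (η i) + lineFun n D p₁ Q b η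
              + 4 * ((p₁ : ℕ) : ZP p₁ Q) * toP D (p₁ * Q) (η i))) = 0 := by
      linear_combination E21 - E20
    have g1 := toQ_eq_zero_of_p₁_mul_eq_zero p₁ Q k1
    have g2 := toQ_eq_zero_of_p₁_mul_eq_zero p₁ Q k2
    simp only [map_mul, map_add, map_ofNat, map_natCast, map_intCast] at g1 g2
    have key : (2 : ZQ Q) ^ 4 * ((p₁ : ℕ) : ZQ Q) * toQ p₁ Q (toP D (p₁ * Q) (η i)) = 0 := by
      linear_combination (-2 : ZQ Q) * g1 + g2
    exact hy ((((h2.pow 4).mul hp₁).mul_right_eq_zero).1 key)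

/-! ### No finer twirl is secret-blind -/

/-- Averaging the offset over a finite family of shifts all annihilated by `η` multiplies the Gram
entry `(u, u+η)` by the size of the family. [folklore] -/
theorem sum_fourierGram_shift (F : Finset (Fin (n + 1) → ℤ)) (b v' : Fin (n + 1) → ℤ)
    (u η : Fin (n + 1) → ZN D p₁ Q)
    (hF : ∀ d ∈ F, (ZMod.stdAddChar (offsetFun n D p₁ Q d η) : ℂ) = 1) :
    ∑ d ∈ F, fourierGram n D p₁ Q b (v' + d) u (u + η)
      = (F.card : ℂ) * fourierGram n D p₁ Q b v' u (u + η) := by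
  rw [Finset.sum_congr rfl fun d hd => by
        rw [fourierGram_shift, add_sub_cancel_left, hF d hd, one_mul],
    Finset.sum_const, nsmul_eq_mul]

/-- **No finer twirl is secret-blind** (T4 sharpness, class form).  Under the hypotheses of
`fourierGram_separates`, for ANY non-empty finite family `F` of integer shifts annihilated by `η`
(`ψ_N(⟨d, η⟩) = 1` for all `d ∈ F` — e.g. any subgroup `K′ ⊊ K` of offsets with `η ∈ K′^⊥ ∖ K^⊥`),
the `F`-averaged Gram entries at `(u, u+η)` still separate `b` from a secret `b + 2p₁m·e_i` of the same
instance class: offset knowledge finer than `K` makes the averaged state secret-dependent.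
[cite: ChenQuantumLattice2024, §3.5.9 pp. 35–37; ZhangExactCoset2025, p. 22 (AC4)] -/
theorem finerTwirl_separates (hP : Odd ((p₁ * Q : ℕ+) : ℕ))
    (hcop : Nat.Coprime (p₁ : ℕ) (Q : ℕ)) (U : Finset (Fin (n + 1)))
    (bk b v' : Fin (n + 1) → ℤ) (hbk : ∀ j, j ∉ U → bk j = b j)
    (η : Fin (n + 1) → ZN D p₁ Q) (hU : U.Nonempty)
    (hη : ¬ ((∀ j ∈ U, toQ p₁ Q (toP D (p₁ * Q) (η j)) = 0)
              ∧ toQ p₁ Q (lineFun n D p₁ Q bk η) = 0))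
    (F : Finset (Fin (n + 1) → ℤ)) (hF0 : F.Nonempty)
    (hF : ∀ d ∈ F, (ZMod.stdAddChar (offsetFun n D p₁ Q d η) : ℂ) = 1) :
    ∃ i ∈ U, ∃ m : ℤ, ∃ u : Fin (n + 1) → ZN D p₁ Q,
      ∑ d ∈ F, fourierGram n D p₁ Q b (v' + d) u (u + η)
        ≠ ∑ d ∈ F, fourierGram n D p₁ Q (b + Pi.single i (2 * ((p₁ : ℕ) : ℤ) * m)) (v' + d) u
            (u + η) := by
  obtain ⟨i, hi, m, u, hne⟩ := fourierGram_separates n D p₁ Q hP hcop U bk b v' hbk η hU hη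
  refine ⟨i, hi, m, u, fun h => hne ?_⟩
  rw [sum_fourierGram_shift n D p₁ Q F _ v' u η hF,
    sum_fourierGram_shift n D p₁ Q F _ v' u η hF] at h
  exact mul_left_cancel₀ (Nat.cast_ne_zero.2 (Finset.card_ne_zero.2 hF0)) h

end Sharp

/-! ### Shape-level form -/

namespace Shape

variable (S : Shape)

/-- **T4 is sharp, for admissible shapes.**  For an admissible shape (odd `p₁`, odd `Q`,
`gcd(p₁,Q) = 1` — C.3), unknown coordinates `U ∌ 0`, `U ≠ ∅`, and `bk = S.b` off `U`: every frequency
difference `η ∉ K^⊥` yields a Gram entry of the Fourier-side state of `S.phi8b` that differs from the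
corresponding entry for the secret `S.b + 2p₁m·e_i` (`i ∈ U`) — a vector with the same planted part and
still `≡ 0 (mod 2p₁)` on `U`, i.e. another admissible secret/error.  Companion of
`Shape.twirledGram_indep`. [cite: ChenQuantumLattice2024, eq. (12) p. 17, C.3 p. 18, §3.5.9 p. 35] -/
theorem fourierGram_separates (h : S.Admissible) (U : Finset (Fin (S.n + 1))) (hU : U.Nonempty)
    (bk : Fin (S.n + 1) → ℤ) (hbk : ∀ j, j ∉ U → bk j = S.b j) (v' : Fin (S.n + 1) → ℤ)
    (η : Fin (S.n + 1) → ZMod S.N)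
    (hη : ¬ ((∀ j ∈ U, toQ S.p₁ S.Q (toP S.D (S.p₁ * S.Q) (η j)) = 0)
              ∧ toQ S.p₁ S.Q (lineFun S.n S.D S.p₁ S.Q bk η) = 0)) :
    ∃ i ∈ U, ∃ m : ℤ, ∃ u : Fin (S.n + 1) → ZMod S.N,
      fourierGram S.n S.D S.p₁ S.Q S.b v' u (u + η)
        ≠ fourierGram S.n S.D S.p₁ S.Q (S.b + Pi.single i (2 * ((S.p₁ : ℕ) : ℤ) * m)) v' u
            (u + η) :=
  Chen2024.fourierGram_separates S.n S.D S.p₁ S.Q h.odd_P h.cop_pQ U bk S.b v' hbk η hU hη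

end Shape

end Literature.Computability.Cryptography.Chen2024
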